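import Summits.AtomisticToContinuum.HydrodynamicLimit.Theorems.CollisionIsometryCLTMacroClosureFvCellsProduct
import HarnessLib

/-!
# Cells-product UPPER bound for hard-core configurations

Input of `stub_blockMGF_twoScale`, line `IdeatorTwoGen1Sketch`, crux `MacroClosure`
(stmt-AtomisticToContinuum-14870).

Proof file (`--supports stmt-AtomisticToContinuum-14870`) for the registered stub
`Barycentric.stub_cellsProductUpper`: the reverse direction of the landed `fv_cells_product_lower`
(`…FvCellsProduct.lean`). For pairwise disjoint measurable cells and prescribed occupation numbers
summing to the number of points, the labelled `d`-separated configurations with exactly `n j`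
points in cell `j` are covered by the union over the `N!/∏ n_j!` labellings of the products of
single-cell `d`-separated configuration sets (inter-cell constraints dropped), whence the bound by
sub-additivity and the product structure of the Haar measure.

Proof: induction on the finite set `T` of cells, generalised over the label type `ι`. Peeling a
cell `C j₀` with occupation `a = n j₀`: a configuration with the prescribed occupations has a
well-defined `a`-set `S` of labels in `C j₀`; the labels of the other cells lie outside `S` (the
cells are disjoint), so after splitting `ι → T3` along `S`
(`MeasurableEquiv.piEquivPiSubtypeProd`, measure preserving) the configuration lies in the
product of the constrained non-overlap set of the `S`-labels in `C j₀` with the smaller problem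
(cells of `T`, same occupations) on the complement of `S` — the cross constraints are simply
dropped. Hence the volume is at most the sum over the `N choose a` subsets `S` of
`W j₀ ×` (bound for the smaller problem), after relabelling `{i // i ∈ S} ≃ Fin a`
(`FvCellsProduct.volume_relabel`), and `(N choose a) · (N - a)! / ∏_{T} (n j)! = N! / ∏_{T'} (n j)!`
closes the induction. No positivity of `d` and no measurability is needed for this direction.

Reference: D. Ruelle, *Statistical Mechanics: Rigorous Results* (1969), §3.4.
-/

noncomputable section

open MeasureTheory Filter Set Topology InformationTheory
open scoped ENNReal ContDiff

namespace Summit.AtomisticToContinuum.HydrodynamicLimit.Theorems.MacroClosureLine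

open Literature.MathematicalPhysics.KineticTheory Literature.Analysis.FluidPDE
open Literature.Analysis.FunctionSpaces


namespace Barycentric

namespace CellsProductUpper

/-! ### Covering by the labelled product pieces -/

/-- **Covering by the labelled pieces.** A configuration with occupation `n j` of every cell
`C j`, `j ∈ insert j₀ T`, lies — for the `n j₀`-set `S` of its labels in `C j₀` — in the preimage
under the splitting `MeasurableEquiv.piEquivPiSubtypeProd` along `S` of the product of the
constrained non-overlap set of the `S`-labels in `C j₀` with the occupation-`n` non-overlap set of
the remaining labels for the cells of `T` (the cells of `T` are disjoint from `C j₀`, so no label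
of `S` is counted there). [folklore] -/
theorem subset_iUnion_pieces {ι κ : Type} [Fintype ι] [DecidableEq ι] [DecidableEq κ]
    (T : Finset κ) (j₀ : κ) (C : κ → Set T3) (n : κ → ℕ) (d : ℝ)
    (hdisj : ∀ j ∈ T, Disjoint (C j₀) (C j)) :
    {q : ι → T3 | (∀ j ∈ insert j₀ T, {i | q i ∈ C j}.ncard = n j) ∧
        ∀ i i', i ≠ i' → d ≤ Torus.euclidDist (q i) (q i')} ⊆
      ⋃ S ∈ (Finset.univ : Finset ι).powersetCard (n j₀),
        MeasurableEquiv.piEquivPiSubtypeProd (fun _ : ι => T3) (fun i => i ∈ S) ⁻¹'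
          ({x : {i // i ∈ S} → T3 | (∀ i, x i ∈ C j₀) ∧
              ∀ i i', i ≠ i' → d ≤ Torus.euclidDist (x i) (x i')} ×ˢ
            {y : {i // i ∉ S} → T3 | (∀ j ∈ T, {i | y i ∈ C j}.ncard = n j) ∧
              ∀ i i', i ≠ i' → d ≤ Torus.euclidDist (y i) (y i')}) := by
  rintro q ⟨hocc, hsep⟩
  -- the set of labels in the peeled cell
  obtain ⟨S, hS⟩ : ∃ S : Finset ι, ∀ i, i ∈ S ↔ q i ∈ C j₀ :=
    ⟨(Set.toFinite {i | q i ∈ C j₀}).toFinset, fun i => by simp⟩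
  have hSset : {i | q i ∈ C j₀} = (↑S : Set ι) := by
    ext i
    simp only [Set.mem_setOf_eq, Finset.mem_coe]
    exact (hS i).symm
  have hScard : S.card = n j₀ := by
    rw [← Set.ncard_coe_finset, ← hSset]
    exact hocc j₀ (Finset.mem_insert_self _ _)
  refine Set.mem_iUnion₂.2 ⟨S, Finset.mem_powersetCard.2 ⟨Finset.subset_univ _, hScard⟩, ?_⟩
  simp only [Set.mem_preimage, Set.mem_prod, MeasurableEquiv.piEquivPiSubtypeProd_apply,
    Set.mem_setOf_eq]
  refine ⟨⟨fun i => (hS i).1 i.2, fun i i' hii' => hsep i i' fun h => hii' (Subtype.ext h)⟩,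
    ⟨fun j hj => ?_, fun i i' hii' => hsep i i' fun h => hii' (Subtype.ext h)⟩⟩
  -- the labels in `C j`, `j ∈ T`, all lie outside `S`
  have himg : (Subtype.val : {i // i ∉ S} → ι) '' {i : {i // i ∉ S} | q i.1 ∈ C j} =
      {i : ι | q i ∈ C j} := by
    ext i
    simp only [Set.mem_image, Set.mem_setOf_eq]
    constructor
    · rintro ⟨i', hi', rfl⟩
      exact hi'
    · intro hi
      exact ⟨⟨i, fun h => Set.disjoint_left.1 (hdisj j hj) ((hS i).1 h) hi⟩, hi, rfl⟩
  rw [← hocc j (Finset.mem_insert_of_mem hj), ← himg,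
    Set.ncard_image_of_injective _ Subtype.val_injective]

/-- Sub-additivity: the volume of the occupation-`n` non-overlap set for the cells of
`insert j₀ T` is at most the sum over the `n j₀`-subsets `S` of the labels of the volumes of the
labelled product pieces. [folklore] -/
theorem volume_le_sum_pieces {ι κ : Type} [Fintype ι] [DecidableEq ι] [DecidableEq κ]
    (T : Finset κ) (j₀ : κ) (C : κ → Set T3) (n : κ → ℕ) (d : ℝ)
    (hdisj : ∀ j ∈ T, Disjoint (C j₀) (C j)) :
    (volume {q : ι → T3 | (∀ j ∈ insert j₀ T, {i | q i ∈ C j}.ncard = n j) ∧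
        ∀ i i', i ≠ i' → d ≤ Torus.euclidDist (q i) (q i')}).toReal ≤
      ∑ S ∈ (Finset.univ : Finset ι).powersetCard (n j₀),
        (volume (MeasurableEquiv.piEquivPiSubtypeProd (fun _ : ι => T3) (fun i => i ∈ S) ⁻¹'
          ({x : {i // i ∈ S} → T3 | (∀ i, x i ∈ C j₀) ∧
              ∀ i i', i ≠ i' → d ≤ Torus.euclidDist (x i) (x i')} ×ˢ
            {y : {i // i ∉ S} → T3 | (∀ j ∈ T, {i | y i ∈ C j}.ncard = n j) ∧
              ∀ i i', i ≠ i' → d ≤ Torus.euclidDist (y i) (y i')}))).toReal := by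
  rw [← ENNReal.toReal_sum (fun S _ => measure_ne_top _ _)]
  refine ENNReal.toReal_mono (ENNReal.sum_ne_top.2 fun S _ => measure_ne_top _ _) ?_
  exact (measure_mono (subset_iUnion_pieces T j₀ C n d hdisj)).trans
    (measure_biUnion_finset_le _ _)

/-! ### One term of the peeling step -/

/-- **One term of the peeling step.** For a label predicate `p` with `a` labels, the volume of
the labelled product piece is `W(a, A) ·` (volume of the smaller problem on the remaining
`m = N - a` labels) (`volume_preserving_piEquivPiSubtypeProd`, `Measure.prod_prod`, relabelling
`{i // p i} ≃ Fin a`), hence at most `W(a, A) · c` for any upper bound `c` of the smaller problem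
(the induction hypothesis). [folklore] -/
theorem term_upper {ι κ : Type} [Fintype ι] [DecidableEq ι] (p : ι → Prop) [DecidablePred p]
    (T : Finset κ) (C : κ → Set T3) (n : κ → ℕ) (A : Set T3) (d : ℝ) (a m : ℕ) (c : ℝ)
    (ha : (Finset.univ.filter p).card = a) (hm : Fintype.card ι = a + m)
    (hIH : ∀ (ι' : Type) [Fintype ι'] [DecidableEq ι'], Fintype.card ι' = m →
      (volume {q : ι' → T3 | (∀ j ∈ T, {i | q i ∈ C j}.ncard = n j) ∧
        ∀ i i', i ≠ i' → d ≤ Torus.euclidDist (q i) (q i')}).toReal ≤ c) :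
    (volume (MeasurableEquiv.piEquivPiSubtypeProd (fun _ : ι => T3) p ⁻¹'
        ({x : {i // p i} → T3 | (∀ i, x i ∈ A) ∧
            ∀ i i', i ≠ i' → d ≤ Torus.euclidDist (x i) (x i')} ×ˢ
          {y : {i // ¬p i} → T3 | (∀ j ∈ T, {i | y i ∈ C j}.ncard = n j) ∧
            ∀ i i', i ≠ i' → d ≤ Torus.euclidDist (y i) (y i')}))).toReal ≤
      (volume {x : Fin a → T3 | (∀ i, x i ∈ A) ∧
        ∀ i i', i ≠ i' → d ≤ Torus.euclidDist (x i) (x i')}).toReal * c := by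
  have hcardp : Fintype.card {i // p i} = a := by
    rw [Fintype.card_subtype]
    exact ha
  have hcardn : Fintype.card {i // ¬p i} = m := by
    rw [Fintype.card_subtype_compl, hcardp, hm, Nat.add_sub_cancel_left]
  have hmp : MeasurePreserving (MeasurableEquiv.piEquivPiSubtypeProd (fun _ : ι => T3) p)
      (volume : Measure (ι → T3))
      ((volume : Measure ({i // p i} → T3)).prod (volume : Measure ({i // ¬p i} → T3))) :=
    volume_preserving_piEquivPiSubtypeProd (fun _ : ι => T3) p
  rw [hmp.measure_preimage_equiv, Measure.prod_prod, ENNReal.toReal_mul,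
    FvCellsProduct.volume_relabel (Fintype.equivFinOfCardEq hcardp) A d]
  exact mul_le_mul_of_nonneg_left (hIH {i // ¬p i} hcardn) ENNReal.toReal_nonneg

/-! ### The induction on the cells -/

/-- The product upper bound, by induction on the finite set of cells (generalised over the label
type). [cite: Ruelle1969, §3.4] -/
theorem cells_product_upper_aux {κ : Type} [DecidableEq κ] (C : κ → Set T3) (n : κ → ℕ) (d : ℝ)
    (T : Finset κ) :
    ∀ (ι : Type) [Fintype ι] [DecidableEq ι],
      (∀ j ∈ T, ∀ j' ∈ T, j ≠ j' → Disjoint (C j) (C j')) →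
      ∑ j ∈ T, n j = Fintype.card ι →
      (volume {q : ι → T3 | (∀ j ∈ T, {i | q i ∈ C j}.ncard = n j) ∧
          ∀ i i', i ≠ i' → d ≤ Torus.euclidDist (q i) (q i')}).toReal ≤
        ((Fintype.card ι).factorial : ℝ) / (∏ j ∈ T, ((n j).factorial : ℝ)) *
          ∏ j ∈ T, (volume {x : Fin (n j) → T3 | (∀ i, x i ∈ C j) ∧
            ∀ i i', i ≠ i' → d ≤ Torus.euclidDist (x i) (x i')}).toReal := by
  induction T using Finset.induction_on with
  | empty =>
    intro ι _ _ _ hsum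
    rw [Finset.sum_empty] at hsum
    haveI : IsEmpty ι := Fintype.card_eq_zero_iff.1 hsum.symm
    have huniv : (volume : Measure (ι → T3)) univ = 1 := by
      show Measure.pi (fun _ : ι => (volume : Measure T3)) univ = 1
      exact measure_univ
    rw [Finset.prod_empty, Finset.prod_empty, ← hsum, Nat.factorial_zero, Nat.cast_one,
      div_one, one_mul]
    calc _ ≤ ((volume : Measure (ι → T3)) univ).toReal :=
          ENNReal.toReal_mono (measure_ne_top _ _) (measure_mono (Set.subset_univ _))
      _ = 1 := by rw [huniv, ENNReal.toReal_one]
  | insert j₀ T hj₀ ih =>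
    intro ι _ _ hdisj hsum
    rw [Finset.sum_insert hj₀] at hsum
    -- data of the peeled cell (`a = n j₀` labels go to `C j₀`, `m` labels remain)
    set m : ℕ := ∑ j ∈ T, n j with hm_def
    set N : ℕ := Fintype.card ι with hN_def
    have hdisjT : ∀ j ∈ T, ∀ j' ∈ T, j ≠ j' → Disjoint (C j) (C j') :=
      fun j hj j' hj' => hdisj j (Finset.mem_insert_of_mem hj) j' (Finset.mem_insert_of_mem hj')
    have hdisj₀ : ∀ j ∈ T, Disjoint (C j₀) (C j) := fun j hj =>
      hdisj j₀ (Finset.mem_insert_self _ _) j (Finset.mem_insert_of_mem hj) fun h => hj₀ (h ▸ hj)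
    -- the induction hypothesis as a uniform upper bound `c` on `m` labels
    set c : ℝ := ((m.factorial : ℝ)) / (∏ j ∈ T, ((n j).factorial : ℝ)) *
      ∏ j ∈ T, (volume {x : Fin (n j) → T3 | (∀ i, x i ∈ C j) ∧
        ∀ i i', i ≠ i' → d ≤ Torus.euclidDist (x i) (x i')}).toReal with hc_def
    have hIH : ∀ (ι' : Type) [Fintype ι'] [DecidableEq ι'], Fintype.card ι' = m →
        (volume {q : ι' → T3 | (∀ j ∈ T, {i | q i ∈ C j}.ncard = n j) ∧
          ∀ i i', i ≠ i' → d ≤ Torus.euclidDist (q i) (q i')}).toReal ≤ c := by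
      intro ι' _ _ hcard
      have h := ih ι' hdisjT hcard.symm
      rw [hcard] at h
      exact h
    -- the cell factor of the peeled cell
    set W₀ : ℝ := (volume {x : Fin (n j₀) → T3 | (∀ i, x i ∈ C j₀) ∧
      ∀ i i', i ≠ i' → d ≤ Torus.euclidDist (x i) (x i')}).toReal with hW₀_def
    -- each `a`-subset of labels contributes at most `W₀ * c`
    have hterm : ∀ S ∈ (Finset.univ : Finset ι).powersetCard (n j₀),
        (volume (MeasurableEquiv.piEquivPiSubtypeProd (fun _ : ι => T3) (fun i => i ∈ S) ⁻¹'
          ({x : {i // i ∈ S} → T3 | (∀ i, x i ∈ C j₀) ∧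
              ∀ i i', i ≠ i' → d ≤ Torus.euclidDist (x i) (x i')} ×ˢ
            {y : {i // i ∉ S} → T3 | (∀ j ∈ T, {i | y i ∈ C j}.ncard = n j) ∧
              ∀ i i', i ≠ i' → d ≤ Torus.euclidDist (y i) (y i')}))).toReal ≤ W₀ * c := by
      intro S hS
      have hSa : (Finset.univ.filter fun i => i ∈ S).card = n j₀ := by
        rw [Finset.filter_univ_mem]
        exact (Finset.mem_powersetCard.1 hS).2
      exact term_upper (fun i => i ∈ S) T C n (C j₀) d (n j₀) m c hSa hsum.symm hIH
    -- counting the subsets and the multinomial arithmetic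
    have hcardPC : (((Finset.univ : Finset ι).powersetCard (n j₀)).card : ℝ) =
        (N.choose (n j₀) : ℝ) := by
      rw [Finset.card_powersetCard, Finset.card_univ]
    have hsub : N - n j₀ = m := by omega
    have hch : ((N.choose (n j₀) : ℕ) : ℝ) * ((n j₀).factorial : ℝ) * (m.factorial : ℝ) =
        (N.factorial : ℝ) := by
      have h := Nat.choose_mul_factorial_mul_factorial (show n j₀ ≤ N by omega)
      rw [hsub] at h
      exact_mod_cast h
    have key : ((N.factorial : ℝ)) / (∏ j ∈ insert j₀ T, ((n j).factorial : ℝ)) *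
        ∏ j ∈ insert j₀ T, (volume {x : Fin (n j) → T3 | (∀ i, x i ∈ C j) ∧
          ∀ i i', i ≠ i' → d ≤ Torus.euclidDist (x i) (x i')}).toReal =
        (N.choose (n j₀) : ℝ) * (W₀ * c) := by
      rw [Finset.prod_insert hj₀, Finset.prod_insert hj₀, ← hch]
      simp only [hc_def, hW₀_def]
      field_simp
    calc (volume {q : ι → T3 | (∀ j ∈ insert j₀ T, {i | q i ∈ C j}.ncard = n j) ∧
            ∀ i i', i ≠ i' → d ≤ Torus.euclidDist (q i) (q i')}).toReal
        ≤ ∑ S ∈ (Finset.univ : Finset ι).powersetCard (n j₀),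
            (volume (MeasurableEquiv.piEquivPiSubtypeProd (fun _ : ι => T3) (fun i => i ∈ S) ⁻¹'
              ({x : {i // i ∈ S} → T3 | (∀ i, x i ∈ C j₀) ∧
                  ∀ i i', i ≠ i' → d ≤ Torus.euclidDist (x i) (x i')} ×ˢ
                {y : {i // i ∉ S} → T3 | (∀ j ∈ T, {i | y i ∈ C j}.ncard = n j) ∧
                  ∀ i i', i ≠ i' → d ≤ Torus.euclidDist (y i) (y i')}))).toReal :=
          volume_le_sum_pieces T j₀ C n d hdisj₀
      _ ≤ ∑ _S ∈ (Finset.univ : Finset ι).powersetCard (n j₀), W₀ * c :=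
          Finset.sum_le_sum hterm
      _ = (N.choose (n j₀) : ℝ) * (W₀ * c) := by
          rw [Finset.sum_const, nsmul_eq_mul, hcardPC]
      _ = ((N.factorial : ℝ)) / (∏ j ∈ insert j₀ T, ((n j).factorial : ℝ)) *
            ∏ j ∈ insert j₀ T, (volume {x : Fin (n j) → T3 | (∀ i, x i ∈ C j) ∧
              ∀ i i', i ≠ i' → d ≤ Torus.euclidDist (x i) (x i')}).toReal := key.symm

end CellsProductUpper

/-- **Cells-product upper bound** (registered stub `stub_cellsProductUpper`): for pairwise
disjoint cells `C j` of the flat torus and occupation numbers `n j` with `∑ n j = N = card ι`,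
the Haar volume of the labelled `d`-separated configurations of `N` points with exactly `n j`
points in the cell `C j` is at most the multinomial weight `N! / ∏ (n j)!` times the product of
the constrained non-overlap volumes of `n j` points in the single cells.
[cite: Ruelle1969, §3.4] -/
theorem stub_cellsProductUpper : ∀ (ι κ : Type) [Fintype ι] [DecidableEq ι] [Fintype κ] [DecidableEq κ]
    (C : κ → Set T3) (n : κ → ℕ) (d : ℝ), (∀ j, MeasurableSet (C j)) →
    (∀ j j', j ≠ j' → Disjoint (C j) (C j')) →
    ∑ j, n j = Fintype.card ι →
    (volume {q : ι → T3 | (∀ j, {i | q i ∈ C j}.ncard = n j) ∧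
        ∀ i i', i ≠ i' → d ≤ Torus.euclidDist (q i) (q i')}).toReal ≤
      ((Fintype.card ι).factorial : ℝ) / (∏ j, ((n j).factorial : ℝ)) *
        ∏ j, (volume {x : Fin (n j) → T3 | (∀ i, x i ∈ C j) ∧
          ∀ i i', i ≠ i' → d ≤ Torus.euclidDist (x i) (x i')}).toReal := by
  intro ι κ _ _ _ _ C n d _ hdisj hsum
  have hset : {q : ι → T3 | (∀ j, {i | q i ∈ C j}.ncard = n j) ∧
        ∀ i i', i ≠ i' → d ≤ Torus.euclidDist (q i) (q i')} =
      {q : ι → T3 | (∀ j ∈ (Finset.univ : Finset κ), {i | q i ∈ C j}.ncard = n j) ∧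
        ∀ i i', i ≠ i' → d ≤ Torus.euclidDist (q i) (q i')} := by
    ext q
    simp only [Set.mem_setOf_eq, Finset.mem_univ, forall_const]
  rw [hset]
  exact CellsProductUpper.cells_product_upper_aux C n d Finset.univ ι
    (fun j _ j' _ hjj' => hdisj j j' hjj') hsum

end Barycentric

end Summit.AtomisticToContinuum.HydrodynamicLimit.Theorems.MacroClosureLine

end
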